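import Mathlib
import Summits.ValiantsHypothesis.ValiantsHypothesis.Theorems.GrenetZeonTwoDimCoefficientsPermanentFlatOrderEval

/-!
# Order-`k` flat subspaces of the permanent have dimension `≤ 2(k−1)n` (LEMMA_k)

Crux `GrenetZeon.TwoDimCoefficients` (stmt-ValiantsHypothesis-8062), line `dim2_cases`, stub
`stub_dualUnipotent`.  This is LEMMA_k of `Cruxes/TwoDimCoefficients/TRIANGULARISABLE-RUNG.md`, the
permanent-side half of the next rung (triangularisable pencils force `m ≥ n^{3/2}/2`); `k = 2` is
`finrank_le_of_hess0_perPoly_isOrtho` (`…PermanentHessianFlat.lean`, p588993) in Hessian language.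

**Theorem (`finrank_le_of_iterD_perPoly_eq_zero`).** Let `K` be a linear subspace of `n × n` matrices
such that all `(k+1)`-st order directional derivatives of `per_n` along `K` vanish identically
(`D_{d₀} ⋯ D_{d_k} per_n = 0` in `ℂ[x]` for all `d_t ∈ K`; equivalently `per_n` has degree `≤ k` on
every coset `x + K`).  Then `dim K ≤ 2kn`.  (`k` rows give `dim K = kn`, so the order is sharp.)

Proof (greedy pivots).  Choose `w₀ ∈ K` and a pivot cell `(r₀, c₀)` with `w₀(r₀,c₀) ≠ 0`; restrict to
the elements of `K` vanishing on row `r₀` and column `c₀` (codimension `≤ 2n`); choose `w₁` there with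
pivot `(r₁, c₁)`; and so on (`pivot_snoc`).  Either some restriction is `0` before `k` pivots, or after
`k` pivots every `v ∈ K` vanishing on the pivot rows/columns is `0`: for a cell `(a, b)` off the pivots,
extend by the pivot `(a, b)` and direction `v`, pick a permutation `τ` with `τ c_t = r_t`, `τ b = a`
(`exists_perm_extend`), and evaluate the vanishing `(k+1)`-st derivative `D_{w₀}⋯D_{w_{k-1}}D_v per_n`
at the zeroed permutation matrix: it equals `(∏_t w_t(r_t,c_t))·v(a,b)` (`eval_testPoint_iterD_perPoly`),
so `v(a,b) = 0`.  Rank–nullity at each pivot gives `dim K ≤ k·2n`.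

HONEST FRAMING: an elementary lemma about the permanent; with the flatness of `per_n` along
bounded-index subspaces of a TRIANGULARISABLE unipotent pencil it yields `m ≥ n^{3/2}/2` in that
sub-case (not typed here); the registered stub stays open-problem grade; `VP ≠ VNP` is not moved.
-/

set_option linter.dupNamespace false

noncomputable section

namespace Summit.ValiantsHypothesis.ValiantsHypothesis.Cruxes.TwoDimCoefficients.DimTwoCases

open MvPolynomial Matrix
open Literature.Computability.AlgebraicComplexity

/-! ### Order-`k+1` flat subspaces have dimension `≤ 2kn` -/

section FlatOrder

variable {n : ℕ}

/-- A permutation extending a partial bijection between pivot columns and pivot rows. [folklore] -/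
theorem exists_perm_extend {k : ℕ} (r c : Fin k → Fin n) (hr : Function.Injective r)
    (hc : Function.Injective c) : ∃ τ : Equiv.Perm (Fin n), ∀ t, τ (c t) = r t := by
  classical
  let e : {x // x ∈ Set.range c} ≃ {x // x ∈ Set.range r} :=
    (Equiv.ofInjective c hc).symm.trans (Equiv.ofInjective r hr)
  refine ⟨e.extendSubtype, fun t => ?_⟩
  rw [Equiv.extendSubtype_apply_of_mem e _ ⟨t, rfl⟩]
  simp [e, Equiv.ofInjective_symm_apply]

/-- Extending a pivot system by one pivot `(a, b)` and one direction `v` vanishing on the old pivot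
rows and columns keeps it a pivot system. [folklore] -/
theorem pivot_snoc {i : ℕ} (r c : Fin i → Fin n) (w : Fin i → (Fin n × Fin n → ℂ))
    (hr : Function.Injective r) (hc : Function.Injective c)
    (hwr : ∀ t j, j < t → ∀ y, w t (r j, y) = 0) (hwc : ∀ t j, j < t → ∀ x, w t (x, c j) = 0)
    (v : Fin n × Fin n → ℂ) (a b : Fin n) (hvr : ∀ j y, v (r j, y) = 0) (hvc : ∀ j x, v (x, c j) = 0)
    (hv : v (a, b) ≠ 0) :
    Function.Injective (Fin.snoc r a : Fin (i + 1) → Fin n) ∧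
    Function.Injective (Fin.snoc c b : Fin (i + 1) → Fin n) ∧
    (∀ t j : Fin (i + 1), j < t → ∀ y,
      (Fin.snoc w v : Fin (i + 1) → (Fin n × Fin n → ℂ)) t ((Fin.snoc r a : Fin (i + 1) → Fin n) j, y) = 0) ∧
    (∀ t j : Fin (i + 1), j < t → ∀ x,
      (Fin.snoc w v : Fin (i + 1) → (Fin n × Fin n → ℂ)) t (x, (Fin.snoc c b : Fin (i + 1) → Fin n) j) = 0) := by
  have ha : a ∉ Set.range r := by
    rintro ⟨j, hj⟩
    exact hv (by rw [← hj]; exact hvr j b)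
  have hb : b ∉ Set.range c := by
    rintro ⟨j, hj⟩
    exact hv (by rw [← hj]; exact hvc j a)
  refine ⟨Fin.snoc_injective_of_injective hr ha, Fin.snoc_injective_of_injective hc hb, ?_, ?_⟩
  · intro t j hjt y
    induction t using Fin.lastCases with
    | last =>
        induction j using Fin.lastCases with
        | last => exact absurd hjt (lt_irrefl _)
        | cast j => rw [Fin.snoc_last, Fin.snoc_castSucc]; exact hvr j y
    | cast t =>
        induction j using Fin.lastCases with
        | last => exact absurd (lt_trans (Fin.castSucc_lt_last t) hjt) (lt_irrefl _)
        | cast j =>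
            rw [Fin.snoc_castSucc, Fin.snoc_castSucc]
            exact hwr t j (Fin.castSucc_lt_castSucc_iff.mp hjt) y
  · intro t j hjt x
    induction t using Fin.lastCases with
    | last =>
        induction j using Fin.lastCases with
        | last => exact absurd hjt (lt_irrefl _)
        | cast j => rw [Fin.snoc_last, Fin.snoc_castSucc]; exact hvc j x
    | cast t =>
        induction j using Fin.lastCases with
        | last => exact absurd (lt_trans (Fin.castSucc_lt_last t) hjt) (lt_irrefl _)
        | cast j =>
            rw [Fin.snoc_castSucc, Fin.snoc_castSucc]
            exact hwc t j (Fin.castSucc_lt_castSucc_iff.mp hjt) x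

/-- **LEMMA_k: order-`(k+1)` flat subspaces of the permanent are small.** If all `(k+1)`-st order
directional derivatives of `per_n` along a linear subspace `K` of `n × n` matrices vanish identically
(equivalently: `per_n` has degree `≤ k` on every coset `x + K`), then `dim K ≤ 2kn`.  (`k = 1`:
`finrank_le_of_hess0_perPoly_isOrtho`, p588993.)  Proof: greedy pivots `(r_t, c_t)` with directions
`w_t ∈ K`, `w_t` vanishing on the earlier pivot rows/columns, `w_t(r_t, c_t) ≠ 0`; each pivot costs
`≤ 2n` dimensions (restriction to row `r_t` and column `c_t`); after `k` pivots every `v ∈ K` vanishing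
on the pivot rows/columns is `0`, since the `(k+1)`-st derivative `D_{w_0}⋯D_{w_{k-1}}D_v per_n` at the
zeroed permutation matrix of `τ` (`τ c_t = r_t`, `τ b = a`) equals `(∏ w_t(r_t,c_t))·v(a,b)`
(`eval_testPoint_iterD_perPoly`). [folklore] -/
theorem finrank_le_of_iterD_perPoly_eq_zero {k : ℕ} (K : Submodule ℂ (Fin n × Fin n → ℂ))
    (hK : ∀ d : Fin (k + 1) → (Fin n × Fin n → ℂ), (∀ t, d t ∈ K) →
      (List.ofFn d).foldr
        (fun u f => mkDerivation ℂ (fun s => (C (u s) : MvPolynomial (Fin n × Fin n) ℂ)) f)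
        (perPoly (Fin n) ℂ) = 0) :
    Module.finrank ℂ K ≤ k * (2 * n) := by
  classical
  -- the restriction map to `i` pivot rows/columns and its rank bound
  have hres : ∀ (i : ℕ) (r c : Fin i → Fin n),
      Module.finrank ℂ K ≤ i * (2 * n) + Module.finrank ℂ
        (LinearMap.ker ((LinearMap.pi fun j : Fin i =>
          LinearMap.prod (LinearMap.pi fun y : Fin n => LinearMap.proj ((r j, y) : Fin n × Fin n))
            (LinearMap.pi fun x : Fin n => LinearMap.proj ((x, c j) : Fin n × Fin n))) ∘ₗ K.subtype)) := by
    intro i r c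
    set Ψ := (LinearMap.pi fun j : Fin i =>
          LinearMap.prod (LinearMap.pi fun y : Fin n => LinearMap.proj (R := ℂ) (φ := fun _ : Fin n × Fin n => ℂ) ((r j, y) : Fin n × Fin n))
            (LinearMap.pi fun x : Fin n => LinearMap.proj (R := ℂ) (φ := fun _ : Fin n × Fin n => ℂ) ((x, c j) : Fin n × Fin n))) ∘ₗ K.subtype with hΨ
    have h1 := LinearMap.finrank_range_add_finrank_ker Ψ
    have h2 : Module.finrank ℂ (LinearMap.range Ψ) ≤ i * (2 * n) := by
      calc Module.finrank ℂ (LinearMap.range Ψ)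
          ≤ Module.finrank ℂ (Fin i → (Fin n → ℂ) × (Fin n → ℂ)) := Submodule.finrank_le _
        _ = i * (2 * n) := by
            rw [Module.finrank_pi_fintype]
            simp only [Module.finrank_prod, Module.finrank_fintype_fun_eq_card, Fintype.card_fin,
              Finset.sum_const, Finset.card_univ, smul_eq_mul]
            ring
    omega
  -- membership in the kernel = vanishing on pivot rows/columns
  have hmem : ∀ (i : ℕ) (r c : Fin i → Fin n) (v : K),
      v ∈ LinearMap.ker ((LinearMap.pi fun j : Fin i =>
          LinearMap.prod (LinearMap.pi fun y : Fin n => LinearMap.proj ((r j, y) : Fin n × Fin n))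
            (LinearMap.pi fun x : Fin n => LinearMap.proj ((x, c j) : Fin n × Fin n))) ∘ₗ K.subtype) ↔
        (∀ j y, (v : Fin n × Fin n → ℂ) (r j, y) = 0) ∧ (∀ j x, (v : Fin n × Fin n → ℂ) (x, c j) = 0) := by
    intro i r c v
    rw [LinearMap.mem_ker]
    constructor
    · intro h
      have h' := fun j => congrFun h j
      refine ⟨fun j y => ?_, fun j x => ?_⟩
      · have := congrArg (fun q => q.1 y) (h' j)
        simpa using this
      · have := congrArg (fun q => q.2 x) (h' j)
        simpa using this
    · rintro ⟨h1, h2⟩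
      funext j
      ext y
      · simpa using h1 j y
      · simpa using h2 j y
  -- CLAIM(i): early termination or a pivot system of length i
  have claim : ∀ i, i ≤ k → (Module.finrank ℂ K ≤ k * (2 * n)) ∨
      ∃ (r c : Fin i → Fin n) (w : Fin i → (Fin n × Fin n → ℂ)),
        Function.Injective r ∧ Function.Injective c ∧ (∀ t, w t ∈ K) ∧
        (∀ t j, j < t → ∀ y, w t (r j, y) = 0) ∧ (∀ t j, j < t → ∀ x, w t (x, c j) = 0) ∧
        (∀ t, w t (r t, c t) ≠ 0) := by
    intro i
    induction i with
    | zero =>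
        intro _
        right
        refine ⟨Fin.elim0, Fin.elim0, Fin.elim0, fun t => Fin.elim0 t, fun t => Fin.elim0 t,
          fun t => Fin.elim0 t, fun t => Fin.elim0 t, fun t => Fin.elim0 t, fun t => Fin.elim0 t⟩
    | succ i ih =>
        intro hi
        rcases ih (by omega) with h | ⟨r, c, w, hr, hc, hwK, hwr, hwc, hwnz⟩
        · exact Or.inl h
        by_cases hbot : LinearMap.ker ((LinearMap.pi fun j : Fin i =>
            LinearMap.prod (LinearMap.pi fun y : Fin n => LinearMap.proj ((r j, y) : Fin n × Fin n))
              (LinearMap.pi fun x : Fin n => LinearMap.proj ((x, c j) : Fin n × Fin n))) ∘ₗ K.subtype) = ⊥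
        · left
          have h := hres i r c
          rw [hbot, finrank_bot] at h
          calc Module.finrank ℂ K ≤ i * (2 * n) + 0 := h
            _ ≤ k * (2 * n) := by nlinarith
        · right
          obtain ⟨v, hvker, hv0⟩ := (Submodule.ne_bot_iff _).mp hbot
          obtain ⟨hvr, hvc⟩ := (hmem i r c v).mp hvker
          have hv0' : (v : Fin n × Fin n → ℂ) ≠ 0 := fun h => hv0 (Subtype.ext h)
          obtain ⟨⟨a, b⟩, hab⟩ := Function.ne_iff.mp hv0'
          obtain ⟨hr', hc', hwr', hwc'⟩ := pivot_snoc r c w hr hc hwr hwc v a b hvr hvc hab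
          refine ⟨Fin.snoc r a, Fin.snoc c b, Fin.snoc w v, hr', hc', ?_, hwr', hwc', ?_⟩
          · intro t
            induction t using Fin.lastCases with
            | last => rw [Fin.snoc_last]; exact v.2
            | cast t => rw [Fin.snoc_castSucc]; exact hwK t
          · intro t
            induction t using Fin.lastCases with
            | last => rw [Fin.snoc_last, Fin.snoc_last, Fin.snoc_last]; exact hab
            | cast t => rw [Fin.snoc_castSucc, Fin.snoc_castSucc, Fin.snoc_castSucc]; exact hwnz t
  rcases claim k le_rfl with h | ⟨r, c, w, hr, hc, hwK, hwr, hwc, hwnz⟩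
  · exact h
  -- with `k` pivots, the kernel is trivial
  have hker : LinearMap.ker ((LinearMap.pi fun j : Fin k =>
      LinearMap.prod (LinearMap.pi fun y : Fin n => LinearMap.proj ((r j, y) : Fin n × Fin n))
        (LinearMap.pi fun x : Fin n => LinearMap.proj ((x, c j) : Fin n × Fin n))) ∘ₗ K.subtype) = ⊥ := by
    rw [Submodule.eq_bot_iff]
    intro v hv
    obtain ⟨hvr, hvc⟩ := (hmem k r c v).mp hv
    apply Subtype.ext
    funext ⟨a, b⟩
    show (v : Fin n × Fin n → ℂ) (a, b) = 0
    by_contra hab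
    obtain ⟨hr', hc', hwr', hwc'⟩ := pivot_snoc r c w hr hc hwr hwc v a b hvr hvc hab
    obtain ⟨τ, hτ⟩ := exists_perm_extend _ _ hr' hc'
    have hev := eval_testPoint_iterD_perPoly (Fin.snoc r a) (Fin.snoc c b) hc' τ hτ
      (Fin.snoc w v) hwr' hwc'
    rw [hK _ (fun t => by
        induction t using Fin.lastCases with
        | last => rw [Fin.snoc_last]; exact v.2
        | cast t => rw [Fin.snoc_castSucc]; exact hwK t), map_zero, Fin.prod_univ_castSucc] at hev
    simp only [Fin.snoc_castSucc, Fin.snoc_last] at hev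
    exact (mul_ne_zero (Finset.prod_ne_zero_iff.mpr fun t _ => hwnz t) hab) hev.symm
  have h := hres k r c
  rw [hker, finrank_bot, add_zero] at h
  exact h

end FlatOrder

end Summit.ValiantsHypothesis.ValiantsHypothesis.Cruxes.TwoDimCoefficients.DimTwoCases

end
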